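import Mathlib
import Summits.Ventures.PercRepro2.PatternV2SP
import Summits.Ventures.PercRepro2.UniversalAlignedSP
import Summits.Ventures.PercRepro2.UniversalAlignedTransport

/-! # (UH*) on every series–parallel pattern, at graph level
(seat mine-b, cell pub-perc-repro2; MINE-B.md §29)

The level-aligned package is carried from the abstract cubes to the configuration posets of
series–parallel PATTERNS `(ends, s, t, O, Y)` (pinned edges `O`, free edges `Y`; `Conf Y` = the blue sets
by inclusion; flow labels `rLabP` = the red flow of `O ∪ (Y ∖ S)`, `bLabP` = the blue flow of `O ∪ S`,
PatternV2SP.lean): the atoms by the order isomorphisms `Bool ≃o Conf {f}` / `Unit ≃o Conf ∅` with the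
packages of UniversalAlignedSP.lean, the compositions by `PackageL.ser` / `PackageL.par` transported along
`splitIso` with the label dictionary `labels_series` / `labels_parallel`.  Result:

  `IsSP.universal : IsSP ends s t O Y → Universal (rLabP ends s t O Y) (bLabP ends s t O Y)`

— on every series–parallel two-terminal graph, every configuration with red flow `0` and blue flow
`a ≥ 1` owns `a` private configurations below it with red flow exactly `1` and blue flow `≥ a − 1`, in
one injective assignment (MINE-B.md §18.1(a), the graph-level form of `SP.universal_all`; it refines
`IsSP.exists_private_red_targets` (PatternDownDomHall.lean), which has no blue level). -/

namespace Summit.Ventures.PercRepro2.V2Closure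

open Finset
open Summit.Ventures.PercRepro2.UHClosure

variable {V : Type*} {E : Type*} [DecidableEq E]

/-! ### The atoms -/

/-- the two configurations of a single free edge: `false` = red (`∅`), `true` = blue (`{f}`) -/
def boolIso (f : E) : Bool ≃o Conf ({f} : Finset E) where
  toFun c := if c then ⟨{f}, le_rfl⟩ else ⟨∅, Finset.empty_subset _⟩
  invFun S := decide (S.1 = {f})
  left_inv c := by cases c <;> simp [Ne.symm (Finset.singleton_ne_empty f)]
  right_inv S := by
    rcases conf_single_cases S with h | h
    · have hS : S = ⟨∅, Finset.empty_subset _⟩ := Subtype.ext h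
      subst hS; simp [Ne.symm (Finset.singleton_ne_empty f)]
    · have hS : S = ⟨{f}, le_rfl⟩ := Subtype.ext h
      subst hS; simp
  map_rel_iff' := by
    intro a b
    cases a <;> cases b <;> simp [Subtype.mk_le_mk]

/-- the value of `boolIso` -/
@[simp] lemma boolIso_apply (f : E) (c : Bool) :
    boolIso f c = if c then (⟨{f}, le_rfl⟩ : Conf ({f} : Finset E)) else ⟨∅, Finset.empty_subset _⟩ := rfl

/-- the single configuration of an edge set without free edges -/
def unitIso : Unit ≃o Conf (∅ : Finset E) where
  toFun _ := ⟨∅, le_rfl⟩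
  invFun _ := ()
  left_inv _ := rfl
  right_inv S := Subtype.ext (conf_empty_eq S).symm
  map_rel_iff' := by intro a b; simp

omit [DecidableEq E] in
/-- the value of `unitIso` -/
@[simp] lemma unitIso_apply (u : Unit) : (unitIso : Unit ≃o Conf (∅ : Finset E)) u = ⟨∅, le_rfl⟩ := rfl

variable [DecidableEq V] [Fintype E]

omit [DecidableEq V] in
/-- the labels of a free edge through `boolIso` -/
lemma free_labels {ends : E → Sym2 V} {s t : V} (hst : s ≠ t) {f : E} (hf : ends f = s(s, t)) (c : Bool) :
    rLabP ends s t ∅ {f} (boolIso f c) = (if c then 0 else 1) ∧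
      bLabP ends s t ∅ {f} (boolIso f c) = (if c then 1 else 0) := by
  cases c <;> simp [rLabP, bLabP, flow_single hst hf, flow_empty]

omit [DecidableEq V] in
/-- the labels of a pinned edge through `unitIso` -/
lemma pin_labels {ends : E → Sym2 V} {s t : V} (hst : s ≠ t) {f : E} (hf : ends f = s(s, t)) (u : Unit) :
    rLabP ends s t {f} ∅ (unitIso u) = 1 ∧ bLabP ends s t {f} ∅ (unitIso u) = 1 := by
  simp [rLabP, bLabP, flow_single hst hf]

omit [DecidableEq V] in
/-- the labels of an absent edge through `unitIso` -/
lemma absent_labels (ends : E → Sym2 V) (s t : V) (u : Unit) :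
    rLabP ends s t ∅ ∅ (unitIso u) = 0 ∧ bLabP ends s t ∅ ∅ (unitIso u) = 0 := by
  simp [rLabP, bLabP, flow_empty]

/-! ### Every pattern -/

/-- **every series–parallel pattern carries a level-aligned package** (induction over the construction) -/
theorem IsSP.packageL {ends : E → Sym2 V} {s t : V} {O Y : Finset E} (h : IsSP ends s t O Y) :
    Nonempty (PackageL (rLabP ends s t O Y) (bLabP ends s t O Y)) := by
  induction h with
  | free hst hf =>
      exact ⟨packageL_free.transport (boolIso _) (fun c => (free_labels hst hf c).1)
        (fun c => (free_labels hst hf c).2)⟩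
  | pin hst hf =>
      exact ⟨packageL_pin.transport unitIso (fun u => (pin_labels hst hf u).1) (fun u => (pin_labels hst hf u).2)⟩
  | absent =>
      exact ⟨packageL_absent.transport unitIso (fun u => (absent_labels ends _ _ u).1)
        (fun u => (absent_labels ends _ _ u).2)⟩
  | ser _ _ hE hs ht hsv htv hst hdisj hdY ih₁ ih₂ =>
      obtain ⟨P₁⟩ := ih₁
      obtain ⟨P₂⟩ := ih₂
      exact ⟨(P₁.ser P₂).transport (splitIso _ _ hdY).symm
        (fun p => (labels_series hE hs ht hsv htv hst hdisj hdY p).1)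
        (fun p => (labels_series hE hs ht hsv htv hst hdisj hdY p).2)⟩
  | par _ _ hE hst hdisj hdY ih₁ ih₂ =>
      obtain ⟨P₁⟩ := ih₁
      obtain ⟨P₂⟩ := ih₂
      exact ⟨(P₁.par P₂).transport (splitIso _ _ hdY).symm
        (fun p => (labels_parallel hE hst hdisj hdY p).1)
        (fun p => (labels_parallel hE hst hdisj hdY p).2)⟩

/-- **(UH*) ON EVERY SERIES–PARALLEL PATTERN, AT GRAPH LEVEL** (MINE-B.md §18.1(a)): every configuration
with red flow `0` and blue flow `a ≥ 1` owns `a` private configurations below it with red flow `1` and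
blue flow `≥ a − 1`, in one injective assignment -/
theorem IsSP.universal {ends : E → Sym2 V} {s t : V} {O Y : Finset E} (h : IsSP ends s t O Y) :
    Universal (rLabP ends s t O Y) (bLabP ends s t O Y) :=
  h.packageL.elim fun P => P.universal

end Summit.Ventures.PercRepro2.V2Closure
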